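import Literature.AlgebraicGeometry.HodgeTheory.StablyNondegenerateRelDimTwo
import Literature.AlgebraicGeometry.HodgeTheory.TypeIIRankTwoPowersHodgeClasses
import HarnessLib

/-!
# Type II of quaternion rank two is stably nondegenerate (Moonen–Zarhin 1995 Type II; Murty 1984 §3 / Gordon Thm. 7.5, §5.9): `B•(Aⁿ) = D•(Aⁿ)` for all `n` when `A` is simple with `End⁰(A)` a totally indefinite quaternion algebra over a totally real `K` and `dim A = 4[K:ℚ]` — unconditional; products with CM abelian varieties (HC_CM as a binder) and products modulo Hazama

Family `hodge`, layer `Literature/AlgebraicGeometry/HodgeTheory`. Research context: cell `pub-hodge-ring2`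
(HONEST FRAMING: research route conditional on HC_CM; not a corollary; Q11.4-sentence-2 already refuted in
dim ≥ 3), Literature lane gen 71, programme R48 — the TYPE II OF QUATERNION RANK TWO instances of the tree's notion
`IsStablyNondegenerate` (`StablyNondegenerateProducts`, Gordon 7.5–7.6 / Moonen–Zarhin condition (D)), exactly as
`StablyNondegenerateRelDimTwo` does for real multiplication of relative dimension two. THEOREMS ONLY (no definition,
no named fact; D-0026); §1 UNCONDITIONAL (`AVSlots.isDivisorGenerated_of_isSimple_isTotallyIndefinite_rankTwo`,
`TypeIIRankTwoPowersHodgeClasses`); §2 products with a CM factor: the equivalence `HC(A^{N+1} × C) ⟺ HC(C)` is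
UNCONDITIONAL (Lombardo's span lemma is a tree theorem, `hodgeConjectureFor_prod_iff_of_hasNoTypeIVFactor_of_isOfCMType`),
the research route's row `HC_CM ⟹ HC(A^{N+1} × C)` displays the binder `hCM` (never asserted); §3 modulo the tree's named
fact `Hazama1989_stablyNondegenerate_prod` (binder `h`, never asserted); no step towards a summit statement.

PUBLISHED STATEMENTS (held `paper:arxiv-alg-geom_9709030` p0017, p0020–p0021): Gordon §5.9 (Moonen–Zarhin 1995 Type II):
«`hg(A)` is the centralizer of `D` in `𝔰𝔭(W, E)`. In particular, `Hdg(Aⁿ) = Div(Aⁿ)` for all `n`»; Gordon 7.5 «(1)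
`Hdg(Aᵏ) = Div(Aᵏ)` for all `k ≥ 1` ⟺ (2) no factor of type (III) and `Hg(A) = Lf(A)`», 7.6 (stably nondegenerate),
7.6.2 (Hazama 1989: products of stably nondegenerate type-IV-free varieties); Murty 1984 §3 (Prop. 7.7.1); Moonen–Zarhin
1999 Thm. (3.2)(1) / Lombardo 2016 Lemma 3.4 («no type IV» × CM).

MAIN RESULTS. §1 `isStablyNondegenerate_of_isSimple_isTotallyIndefinite_rankTwo`,
`isStablyNondegenerate_powSucc_of_isSimple_isTotallyIndefinite_rankTwo` (unconditional). §2
`hodgeConjectureFor_powSucc_prod_iff_of_isSimple_isTotallyIndefinite_rankTwo_of_isOfCMType` (`HC(A^{N+1} × C) ⟺ HC(C)`,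
unconditional), `hodgeConjectureFor_powSucc_prod_of_isSimple_isTotallyIndefinite_rankTwo_of_cmHodgeHypothesis` (HC_CM as
a binder), `…_of_isOfCMType_of_dim_le_three` (UNCONDITIONAL for `dim C ≤ 3`). §3 (modulo Hazama) `isStablyNondegenerate_powSucc_prod_powSucc_of_typeIIRankTwo_of_hazama` (two type II factors),
`isStablyNondegenerate_powSucc_prod_powSucc_of_typeIIRankTwo_relDimTwo_of_hazama` (mixed with real multiplication of
relative dimension two), `hodgeConjectureFor_of_isIsogenous_…`, `hodgeConjectureFor_powSucc_prod_powSucc_of_typeIIRankTwo_of_hazama`.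

## References

* [Gordon1999HodgeAVSurvey] B. B. Gordon, *A survey of the Hodge conjecture for abelian varieties*, §5.9, Thm. 7.5,
  Def. 7.6, Thm. 7.6.2. [cite: Gordon1999HodgeAVSurvey, Thm. 7.5 (1) and Def. 7.6]
* [Hazama1989] F. Hazama, Duke Math. J. 58 (1989) 31–37. [cite: Hazama1989, Thm. (= Gordon 7.6.2)]
* [MoonenZarhin1995Duke] B. Moonen, Yu. Zarhin, Duke Math. J. 77 (1995), Type II. [cite: MoonenZarhin1995Duke, Type II]
* [Chi1992] W. Chi, Amer. J. Math. 114 (1992), Thm. 7.4. [cite: Chi1992, Thm. 7.4]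
* [Murty1984] V. K. Murty, Math. Ann. 268 (1984), §3. [cite: Murty1984, §3]
* [MoonenZarhin1999LowDim] B. Moonen, Yu. Zarhin, Math. Ann. 315 (1999), §2 (D), §3 Thm. (3.2). [cite: MoonenZarhin1999LowDim, §3 Thm. (3.2)]
* [Lombardo2016] D. Lombardo, Ann. Inst. Fourier 66 (2016), Lemma 3.4. [cite: Lombardo2016, Lemma 3.4 (p. 1229)]
* [Deligne2000] P. Deligne, *The Hodge conjecture* (Clay, 2000), §1. [cite: Deligne2000, §1]
-/

noncomputable section

open CategoryTheory Module NumberField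

namespace Literature.AlgebraicGeometry.HodgeTheory

open Literature.AlgebraicGeometry.Motives (AbelianVariety)
open Literature.AlgebraicGeometry.ComplexMultiplication
open Literature.AlgebraicGeometry.Milne1999
open Literature.RingTheory.CentralSimple
open Literature.NumberTheory.Automorphic (IsQuaternionAlgebra)

section TypeIIRankTwo

variable {A : AbelianVariety ℂ} {K : Type} [Field K] [NumberField K] [Algebra K A.endAlgebra]
  [IsScalarTower ℚ K A.endAlgebra] [IsQuaternionAlgebra K A.endAlgebra]

/-! ### §1 Type II of quaternion rank two is stably nondegenerate — unconditional -/

variable (A) in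
/-- **Type II of quaternion rank two is stably nondegenerate — UNCONDITIONAL** (Moonen–Zarhin 1995 Type II: «`Hdg(Aⁿ) =
Div(Aⁿ)` for all `n`»; Murty 1984 §3; the tree's `AbelianVariety.isDivisorGenerated_powSucc_of_isSimple_isTotallyIndefinite_rankTwo`).
[cite: MoonenZarhin1995Duke, Type II] [cite: Murty1984, §3] [cite: Gordon1999HodgeAVSurvey, Thm. 7.5 (1) and Def. 7.6] -/
theorem isStablyNondegenerate_of_isSimple_isTotallyIndefinite_rankTwo [IsTotallyReal K] (hA : A.IsSimple)
    (hind : IsTotallyIndefinite K A.endAlgebra) (hdim : A.dim = 4 * Module.finrank ℚ K) : IsStablyNondegenerate A :=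
  fun N => AbelianVariety.isDivisorGenerated_powSucc_of_isSimple_isTotallyIndefinite_rankTwo A hA hind hdim N

variable (A) in
/-- **All powers `A^{M+1}` of a type II variety of quaternion rank two are stably nondegenerate — UNCONDITIONAL** (the
iterated powers have slots over `A`, `exists_avSlots_powSucc_powSucc`;
`AVSlots.isDivisorGenerated_of_isSimple_isTotallyIndefinite_rankTwo`). [cite: MoonenZarhin1995Duke, Type II]
[cite: Gordon1999HodgeAVSurvey, Rem. 7.6.1] -/
theorem isStablyNondegenerate_powSucc_of_isSimple_isTotallyIndefinite_rankTwo [IsTotallyReal K] (hA : A.IsSimple)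
    (hind : IsTotallyIndefinite K A.endAlgebra) (hdim : A.dim = 4 * Module.finrank ℚ K) (M : ℕ) :
    IsStablyNondegenerate (A.powSucc M) := by
  intro N
  obtain ⟨n, g, hg⟩ := exists_avSlots_powSucc_powSucc A M N
  exact hg.isDivisorGenerated_of_isSimple_isTotallyIndefinite_rankTwo hA hind hdim

/-! ### §2 Products with abelian varieties of CM type («no type IV» × CM; HC_CM only as a binder) -/

/-- **`HC(A^{N+1} × C) ⟺ HC(C)`** for a simple `A` of type II of quaternion rank two and `C` of CM type — UNCONDITIONAL
(Lombardo 2016 Lemma 3.4 / Moonen–Zarhin (3.2)(1) «no type IV» × CM, the tree's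
`hodgeConjectureFor_prod_iff_of_hasNoTypeIVFactor_of_isOfCMType`; «no type IV» by
`hasNoTypeIVFactor_of_isSimple_isTotallyIndefinite`; `HC(A^{N+1})` by §1). [cite: Lombardo2016, Lemma 3.4 (p. 1229)]
[cite: MoonenZarhin1999LowDim, §3 Thm. (3.2)] [cite: MoonenZarhin1995Duke, Type II] -/
theorem hodgeConjectureFor_powSucc_prod_iff_of_isSimple_isTotallyIndefinite_rankTwo_of_isOfCMType [IsTotallyReal K]
    (hA : A.IsSimple) (hind : IsTotallyIndefinite K A.endAlgebra) (hdim : A.dim = 4 * Module.finrank ℚ K) (N : ℕ)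
    {C : AbelianVariety ℂ} (hCt : Milne1999.IsOfCMType C) :
    HodgeConjectureFor ((A.powSucc N).prod C).dim ((A.powSucc N).prod C).X ↔ HodgeConjectureFor C.dim C.X := by
  rw [hodgeConjectureFor_prod_iff_of_hasNoTypeIVFactor_of_isOfCMType (A.powSucc N) C
    ((hasNoTypeIVFactor_of_isSimple_isTotallyIndefinite hA hind).powSucc N) hCt]
  exact ⟨fun h => h.2,
    fun h => ⟨hodgeConjectureFor_powSucc_of_isSimple_isTotallyIndefinite_rankTwo hA hind hdim N, h⟩⟩

/-- **HC_CM ⟹ HC(`A^{N+1} × C`)** for a simple `A` of type II of quaternion rank two and `C` of CM type — the research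
route's row, CONDITIONAL ON HC_CM (the binder `hCM`, Milne's per-variety form; not a corollary of anything unconditional
here). [cite: Lombardo2016, Lemma 3.4 (p. 1229)] [cite: MoonenZarhin1999LowDim, §3 Thm. (3.2)] [cite: Deligne2000, §1] -/
theorem hodgeConjectureFor_powSucc_prod_of_isSimple_isTotallyIndefinite_rankTwo_of_cmHodgeHypothesis [IsTotallyReal K]
    (hCM : ∀ Y : AbelianVariety ℂ, Milne1999.CMHodgeHypothesisAt Y) (hA : A.IsSimple)
    (hind : IsTotallyIndefinite K A.endAlgebra) (hdim : A.dim = 4 * Module.finrank ℚ K) (N : ℕ)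
    {C : AbelianVariety ℂ} (hCt : Milne1999.IsOfCMType C) :
    HodgeConjectureFor ((A.powSucc N).prod C).dim ((A.powSucc N).prod C).X :=
  hodgeConjectureFor_powSucc_prod_of_hasNoTypeIVFactor_of_cmHodgeHypothesis hCM A C
    (hasNoTypeIVFactor_of_isSimple_isTotallyIndefinite hA hind) hCt N
    (hodgeConjectureFor_powSucc_of_isSimple_isTotallyIndefinite_rankTwo hA hind hdim N)

/-- **UNCONDITIONAL: `HC(A^{N+1} × C)` for a simple `A` of type II of quaternion rank two and `C` of CM type with
`dim C ≤ 3`** (the equivalence above with the tree's `hodgeConjectureFor_of_dim_le_three_holds`: the Hodge conjecture for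
smooth projective varieties of dimension `≤ 3`, Lefschetz `(1,1)` + hard Lefschetz). [cite: Lombardo2016, Lemma 3.4 (p. 1229)]
[cite: MoonenZarhin1999LowDim, Introduction and §3 Thm. (3.2)] [cite: MoonenZarhin1995Duke, Type II] -/
theorem hodgeConjectureFor_powSucc_prod_of_isSimple_isTotallyIndefinite_rankTwo_of_isOfCMType_of_dim_le_three
    [IsTotallyReal K] (hA : A.IsSimple) (hind : IsTotallyIndefinite K A.endAlgebra)
    (hdim : A.dim = 4 * Module.finrank ℚ K) (N : ℕ) {C : AbelianVariety ℂ} (hCt : Milne1999.IsOfCMType C)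
    (hC3 : C.dim ≤ 3) : HodgeConjectureFor ((A.powSucc N).prod C).dim ((A.powSucc N).prod C).X :=
  (hodgeConjectureFor_powSucc_prod_iff_of_isSimple_isTotallyIndefinite_rankTwo_of_isOfCMType hA hind hdim N hCt).2
    (hodgeConjectureFor_of_dim_le_three_holds hC3 Motives.AbelianVariety.isSmoothProjective_holds)

/-! ### §3 Products of two such varieties, modulo Hazama 1989 -/

/-- **Two type II varieties of quaternion rank two, modulo Hazama ONLY**: `A^{M+1} × B^{N+1}` is stably nondegenerate
(both factors unconditionally so and type-IV-free). [cite: Hazama1989, Thm. (= Gordon 7.6.2)]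
[cite: MoonenZarhin1995Duke, Type II] -/
theorem isStablyNondegenerate_powSucc_prod_powSucc_of_typeIIRankTwo_of_hazama [IsTotallyReal K]
    (h : Hazama1989_stablyNondegenerate_prod) (hA : A.IsSimple) (hind : IsTotallyIndefinite K A.endAlgebra)
    (hdim : A.dim = 4 * Module.finrank ℚ K) {B : AbelianVariety ℂ} {K' : Type} [Field K'] [NumberField K']
    [IsTotallyReal K'] [Algebra K' B.endAlgebra] [IsScalarTower ℚ K' B.endAlgebra] [IsQuaternionAlgebra K' B.endAlgebra]
    (hB : B.IsSimple) (hindB : IsTotallyIndefinite K' B.endAlgebra) (hdimB : B.dim = 4 * Module.finrank ℚ K')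
    (M N : ℕ) : IsStablyNondegenerate ((A.powSucc M).prod (B.powSucc N)) :=
  (isStablyNondegenerate_powSucc_of_isSimple_isTotallyIndefinite_rankTwo A hA hind hdim M).prod_of_hazama h
    (isStablyNondegenerate_powSucc_of_isSimple_isTotallyIndefinite_rankTwo B hB hindB hdimB N)
    ((hasNoTypeIVFactor_of_isSimple_isTotallyIndefinite hA hind).powSucc M)
    ((hasNoTypeIVFactor_of_isSimple_isTotallyIndefinite hB hindB).powSucc N)

/-- **Mixed: type II of quaternion rank two with real multiplication of relative dimension two, modulo Hazama ONLY**.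
[cite: Hazama1989, Thm. (= Gordon 7.6.2)] [cite: MoonenZarhin1995Duke, Type II] -/
theorem isStablyNondegenerate_powSucc_prod_powSucc_of_typeIIRankTwo_relDimTwo_of_hazama [IsTotallyReal K]
    (h : Hazama1989_stablyNondegenerate_prod) (hA : A.IsSimple) (hind : IsTotallyIndefinite K A.endAlgebra)
    (hdim : A.dim = 4 * Module.finrank ℚ K) (B : AbelianVariety ℂ) (hFB : IsField B.endAlgebra)
    [IsTotallyReal (EndField B hFB)] (hdegB : 2 * Module.finrank ℚ B.endAlgebra = B.dim) (M N : ℕ) :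
    IsStablyNondegenerate ((A.powSucc M).prod (B.powSucc N)) :=
  (isStablyNondegenerate_powSucc_of_isSimple_isTotallyIndefinite_rankTwo A hA hind hdim M).prod_of_hazama h
    (isStablyNondegenerate_powSucc_of_isTotallyReal_of_two_mul_finrank_eq B hFB hdegB N)
    ((hasNoTypeIVFactor_of_isSimple_isTotallyIndefinite hA hind).powSucc M)
    ((hasNoTypeIVFactor_of_isTotallyReal B hFB).powSucc N)

/-- **HC for everything isogenous to a power of `A^{M+1} × B^{N+1}`, two type II factors — modulo Hazama ONLY.**
[cite: Hazama1989, Thm. (= Gordon 7.6.2)] [cite: MoonenZarhin1995Duke, Type II] -/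
theorem hodgeConjectureFor_of_isIsogenous_powSucc_powSucc_prod_powSucc_of_typeIIRankTwo_of_hazama [IsTotallyReal K]
    (h : Hazama1989_stablyNondegenerate_prod) {X : AbelianVariety ℂ} (hA : A.IsSimple)
    (hind : IsTotallyIndefinite K A.endAlgebra) (hdim : A.dim = 4 * Module.finrank ℚ K) {B : AbelianVariety ℂ}
    {K' : Type} [Field K'] [NumberField K'] [IsTotallyReal K'] [Algebra K' B.endAlgebra] [IsScalarTower ℚ K' B.endAlgebra]
    [IsQuaternionAlgebra K' B.endAlgebra] (hB : B.IsSimple) (hindB : IsTotallyIndefinite K' B.endAlgebra)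
    (hdimB : B.dim = 4 * Module.finrank ℚ K') {M N L : ℕ}
    (hX : AbelianVariety.IsIsogenous X (((A.powSucc M).prod (B.powSucc N)).powSucc L)) :
    HodgeConjectureFor X.dim X.X :=
  (isStablyNondegenerate_powSucc_prod_powSucc_of_typeIIRankTwo_of_hazama h hA hind hdim hB hindB hdimB M
    N).hodgeConjectureFor_of_isIsogenous_powSucc hX

/-- The `L = 0` spelling: HC(`A^{M+1} × B^{N+1}`) for two type II factors of quaternion rank two, modulo Hazama only.
[cite: Hazama1989, Thm. (= Gordon 7.6.2)] [cite: MoonenZarhin1995Duke, Type II] -/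
theorem hodgeConjectureFor_powSucc_prod_powSucc_of_typeIIRankTwo_of_hazama [IsTotallyReal K]
    (h : Hazama1989_stablyNondegenerate_prod) (hA : A.IsSimple) (hind : IsTotallyIndefinite K A.endAlgebra)
    (hdim : A.dim = 4 * Module.finrank ℚ K) {B : AbelianVariety ℂ} {K' : Type} [Field K'] [NumberField K']
    [IsTotallyReal K'] [Algebra K' B.endAlgebra] [IsScalarTower ℚ K' B.endAlgebra] [IsQuaternionAlgebra K' B.endAlgebra]
    (hB : B.IsSimple) (hindB : IsTotallyIndefinite K' B.endAlgebra) (hdimB : B.dim = 4 * Module.finrank ℚ K')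
    (M N : ℕ) :
    HodgeConjectureFor ((A.powSucc M).prod (B.powSucc N)).dim ((A.powSucc M).prod (B.powSucc N)).X :=
  (isStablyNondegenerate_powSucc_prod_powSucc_of_typeIIRankTwo_of_hazama h hA hind hdim hB hindB hdimB M
    N).hodgeConjectureFor

end TypeIIRankTwo

end Literature.AlgebraicGeometry.HodgeTheory

end
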